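import Summits.QuantumFields.YangMills.Theorems.BalabanUVNodesN08HaarCompatibilityGuardHybridDensity
import HarnessLib

/-!
# R3 (cell `ym3-torus`, YM₃ on T³ — a ladder RUNG, NOT d = 4, NOT infinite volume, NOT a mass gap, NOT the Clay problem) —
# **(F-A) THE RESTRICTED ONE-LEVEL DENSITY OF THE BRANCH EXPANSION: `(Ū^{S′})_*(dU ↾ G_S) ≤ K^{|S′|}·dU(Adm_S) • dV` — the hybrid
# transport of product Haar RESTRICTED to «every guard of `S` fires», EML branch on `S′ ⊆ S`, is dominated by coarse product Haar with
# the (H_K) constant to the power `|S′|` times the probability that the background ADMITS the guards of `S`**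

Width seat `ym-ust-19936-w8` g12 on crux `stmt-QuantumFields-19936` `UnitScaleTilt.HistoryTailL` (`--supports`, helper; THEOREMS ONLY, 0 `def`, 0 `sorry`).
Item (F-A) of LEAD ★w1 g12's design note `Cruxes/HistoryTailL/HTopBranchExpansion.md` §3 (A₁) ∕ §6: the one-level input of the MONOTONE STACKING (A₃)
(✓`UV3BranchExpansionDomination.map_restrict_iterate_le_prod_smul`: `((λ_k)↾E_k).map T_k ≤ c_k • λ_{k+1}` per level), at `λ_k = dU_k`, `E_k = G_{s_k}`,
`T_k = Ū^{s′_k}` (n08-w3's hybrid: print's (0.4) averaging `avgFun ℰ` on `S′`, the straight transporter off `S′`).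
RECORD CURRENCY (★★OWNER WORDS 84 (2) ∕ 85 (4) ∕ ACK 145): record-independent kinematics of product Haar and the guarded averaging (any `Params`, any group with the
lit carrier instances); SUPPLY-side for the hTop-class rows `fibre55Win` ∕ `fibre57LowOn` of the χ record inside NODE O B3 and for Track A's N08 — NOT a 19936 registry row.

THE ARGUMENT (n08-w3 part 36 ✓`…GuardHybridDensity.map_hybrid_le_lintegral_smul`, WITH THE GUARD INDICATOR KEPT INSIDE).  Resample every private crossing bond
`β(c) = centralBond c`: `(U, g) ↦ U[β ↦ g]` preserves `dU_k` (lit `measurePreserving_resample`); by locality (`isLocal_hybrid`) the output coordinate `c` of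
`Ū^{S′}(U[β ↦ g])` is `Ū^{S′}(U[β(c) ↦ g_c]) c`, and — the one new letter, §1 — the guard of `c` reads `β(c)` and NO other private bond, so
`1_{G_S}(U[β ↦ g]) = Π_{c∈S} 1_{G_c}(U[β(c) ↦ g_c])`.  For a fixed background `U` the `g`-integral is therefore the PRODUCT over `c` of one-variable fibre laws
RESTRICTED to the guard section: `c ∈ S′` ⇒ `≤ K•Haar` on admitting backgrounds and `0` otherwise ((H_K), n08-w3's letter `hK` verbatim); `c ∈ S∖S′` ⇒ a two-sided
translate of restricted Haar, `≤ Haar` (`0` if not admitting); `c ∉ S` ⇒ Haar exactly.  Product domination (✓`pi_le_prod_smul_pi`) and integration over the background give the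
bound; the admitting set enters as an outer measure, in the letter of n08-w3 part 19's ✓`measure_forall_guardAdmitting_le`, which IS (A₂):
`Haar{dist1 < δ′}^{|S|} · dU(Adm_S) ≤ Haar{dist1 < δ + δ′}^{|S|(L^{d−1}−1)}`.

CONTENTS.  §1 `small_resample_iff` (the guard reads only its own private bond; over n08-w3's ✓`loopHol_extend_eq_loopHol_update`), `measurableSet_smallSection`.  §2 ★ `pi_fibre_le_of_admitting` ∕
`pi_fibre_eq_zero_of_not_admitting` (per background: the product of the restricted fibre laws is `≤ K^{|S′|} • dV`, and `= 0` off `∩_{c∈S} Adm_c`).  §3 ★★★ `map_restrict_guardAll_hybrid_le` — the theorem above, in the letter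
`((dU_k)↾{∀ c ∈ S, Small ℰ U c}).map (Ū^{S′}) ≤ (K^{|S′|} · dU_k {U | ∀ c ∈ S, ∃ g, Small ℰ (U[β(c) ↦ g]) c}) • dU_{k+1}`.

HONEST SCOPE.  [folklore] measure theory over pub-balaban's resampling lemma and n08-w3's parts 34∕36 BY IMPORT; (H_K) is a HYPOTHESIS (discharged elsewhere: ✓`…GuardCoreLawSU2`,
✓`…GuardCoreLawSUNExplicitSlot`); ONE level; (A₂), (M), (C) and the assembly of hTop are NOT here; nothing of hTop ∕ (T8) ∕ (O‴χₛ) ∕ `HistoryTailL` (19936) ∕ the rung ∕ d = 4 ∕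
a mass gap ∕ Clay is proved.  YM₃ on T³ is rung R3 of the ladder, not the Clay problem.

References: T. Bałaban, Commun. Math. Phys. **109** (1987) 249–301 [Balaban1987RG1] ((0.4) p. 253, the guarded averaging); T. Bałaban, Commun. Math. Phys. **98** (1985)
17–51 [Balaban1985Averaging] ((10) p. 19, product Haar).
-/

set_option autoImplicit false

noncomputable section

open MeasureTheory Function
open scoped ENNReal

namespace Summit.QuantumFields.YangMills.Theorems.UV3BranchExpansionRestrictedDensity

open Literature.MathematicalPhysics.QuantumFieldTheory.Balaban1983to89
open Literature.MathematicalPhysics.QuantumFieldTheory.Balaban1983to89.AveragingRT (axialAvg measurable_axialAvg)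
open Literature.MathematicalPhysics.QuantumFieldTheory.Balaban1983to89.BlockAveraging (Idx loopHol Small avgFun measurable_avgFun measurableSet_small)
open Literature.MathematicalPhysics.QuantumFieldTheory.Balaban1983to89.BlockAveragingHaarAC
  (centralBond centralBond_injective)
open Literature.MathematicalPhysics.QuantumFieldTheory.Balaban1983to89.T4TriangularPushforward (IsLocal measurePreserving_resample apply_resample_eq)
open Summit.QuantumFields.YangMills.BalabanUVNodes.N08HaarCompatibilityGuardHybridPartition (measurable_hybrid measurableSet_guardAll)
open Summit.QuantumFields.YangMills.BalabanUVNodes.N08HaarCompatibilityGuardHybridDensity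
  (isLocal_hybrid hybrid_fibre_of_not_mem map_hybrid_fibre_eq_haar_of_not_mem measurable_hybrid_fibreMap)
open Summit.QuantumFields.YangMills.BalabanUVNodes.N08HaarCompatibilityGuardMixtureDensity (pi_le_prod_smul_pi)
open Summit.QuantumFields.YangMills.BalabanUVNodes.N08HaarCompatibilityGuardAdmitting (loopHol_extend_eq_loopHol_update)

/-! ## §1 The guard of `c` reads only its own private crossing bond -/
section Guard

variable {P : Params} {j : ℕ} {G : Type*} [GaugeGroup G] (ℰ : LoopAverage G) [DecidableEq (PBond P (j + 1))]

omit [DecidableEq (PBond P (j + 1))] in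
/-- **THE GUARD OF `c` AFTER RESAMPLING ALL PRIVATE BONDS = AFTER RESAMPLING `β(c)` ALONE** (n08-w3 part 19's ✓`loopHol_extend_eq_loopHol_update`: a central crossing bond
`β(c′)` occurs in a loop word of `c` only for `c′ = c`). [cite: Balaban1987RG1, (0.4) p.253] -/
theorem small_resample_iff (hj : j + 1 ≤ P.m + P.K) (U : GaugeField P j G) (g : PBond P (j + 1) → G) (c : PBond P (j + 1)) :
    Small ℰ (Function.extend centralBond g U) c ↔ Small ℰ (update U (centralBond c) (g c)) c := by
  classical
  simp only [BlockAveraging.Small, loopHol_extend_eq_loopHol_update hj U g c]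

variable [MeasurableSpace G] [RegularGaugeGroup G]

omit [DecidableEq (PBond P (j + 1))] in
/-- The guard section `{y | Small ℰ (U[β(c) ↦ y]) c}` of a background is measurable. [folklore] -/
theorem measurableSet_smallSection (U : GaugeField P j G) (c : PBond P (j + 1)) :
    MeasurableSet {y : G | Small ℰ (update U (centralBond c) y) c} := by
  classical
  exact (measurableSet_small ℰ c).preimage (measurable_update (a := centralBond c) U)

end Guard

/-! ## §2 Per background: the product of the restricted fibre laws -/
section Fibre

variable {P : Params} {j : ℕ} {G : Type*} [GaugeGroup G] (ℰ : LoopAverage G) [DecidableEq (PBond P (j + 1))]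
  [MeasurableSpace G] [RegularGaugeGroup G] [HaarData G]

/-- ★ **PER ADMITTING BACKGROUND, THE PRODUCT OF THE RESTRICTED FIBRE LAWS IS `≤ K^{|S′|} • dV`**: for `S′ ⊆ S` and a background `U` admitting every guard of `S`, the
product over `c` of the images of Haar RESTRICTED to the guard section of `c` (for `c ∈ S`; unrestricted for `c ∉ S`) under the one-variable fibre maps
`y ↦ Ū^{S′}(U[β(c) ↦ y]) c` is dominated by `K^{|S′|} • dV` ((H_K) at the bonds of `S′`, two-sided translates at `S ∖ S′`, Haar exactly off `S′`). [cite: Balaban1987RG1, (0.4) p.253] -/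
theorem pi_fibre_le_of_admitting (hj : j + 1 ≤ P.m + P.K) (hE : ∀ n, Measurable fun W : Fin (n + 1) → G => ℰ.E W)
    (S S' : Finset (PBond P (j + 1))) (hS' : S' ⊆ S) {K : ℝ≥0∞} (hK1 : 1 ≤ K) (hKtop : K ≠ ∞)
    (hK : ∀ c ∈ S', ∀ U : GaugeField P j G, (∃ g : G, Small ℰ (update U (centralBond c) g) c) →
      (HaarData.haar : Measure G).map (fun g => avgFun ℰ (update U (centralBond c) g) c) ≤ K • (HaarData.haar : Measure G))
    (U : GaugeField P j G) (hadm : ∀ c ∈ S, ∃ g : G, Small ℰ (update U (centralBond c) g) c) :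
    Measure.pi (fun c : PBond P (j + 1) =>
        ((HaarData.haar : Measure G).restrict (if c ∈ S then {y : G | Small ℰ (update U (centralBond c) y) c} else Set.univ)).map
          (fun y => (fun c' => if c' ∈ S' then avgFun ℰ (update U (centralBond c) y) c' else axialAvg (update U (centralBond c) y) c' :
            GaugeField P (j + 1) G) c)) ≤
      (K ^ S'.card) • fieldMeasure P (j + 1) G := by
  classical
  haveI := HaarData.isProb (G := G)
  -- factor constants
  set A : PBond P (j + 1) → ℝ≥0∞ := fun c => if c ∈ S' then K else 1 with hA
  have hA0 : ∀ c, A c ≠ 0 := fun c => by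
    by_cases hc : c ∈ S'
    · simp only [hA, if_pos hc]; exact ne_of_gt (lt_of_lt_of_le zero_lt_one hK1)
    · simp only [hA, if_neg hc]; exact one_ne_zero
  have hAtop : ∀ c, A c ≠ ∞ := fun c => by
    by_cases hc : c ∈ S'
    · simp only [hA, if_pos hc]; exact hKtop
    · simp only [hA, if_neg hc]; exact ENNReal.one_ne_top
  have hfibm : ∀ c, Measurable fun y : G => (fun c' => if c' ∈ S' then avgFun ℰ (update U (centralBond c) y) c'
      else axialAvg (update U (centralBond c) y) c' : GaugeField P (j + 1) G) c := fun c =>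
    (measurable_hybrid_fibreMap ℰ hE S' c).comp (measurable_const.prodMk measurable_id)
  have hfac : ∀ c, ((HaarData.haar : Measure G).restrict (if c ∈ S then {y : G | Small ℰ (update U (centralBond c) y) c} else Set.univ)).map
      (fun y => (fun c' => if c' ∈ S' then avgFun ℰ (update U (centralBond c) y) c' else axialAvg (update U (centralBond c) y) c' :
        GaugeField P (j + 1) G) c) ≤ A c • (HaarData.haar : Measure G) := by
    intro c
    refine (Measure.map_mono Measure.restrict_le_self (hfibm c)).trans ?_
    by_cases hc : c ∈ S'
    · have hA' : A c = K := by simp only [hA, if_pos hc]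
      have hfun : (fun y : G => (fun c' => if c' ∈ S' then avgFun ℰ (update U (centralBond c) y) c' else axialAvg (update U (centralBond c) y) c' :
          GaugeField P (j + 1) G) c) = fun y => avgFun ℰ (update U (centralBond c) y) c := funext fun y => if_pos hc
      rw [hA', hfun]
      exact hK c hc U (hadm c (hS' hc))
    · have hA' : A c = 1 := by simp only [hA, if_neg hc]
      rw [hA', one_smul]
      exact (map_hybrid_fibre_eq_haar_of_not_mem ℰ hj S' U hc).le
  have hpi := pi_le_prod_smul_pi
    (fun c => ((HaarData.haar : Measure G).restrict (if c ∈ S then {y : G | Small ℰ (update U (centralBond c) y) c} else Set.univ)).map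
      (fun y => (fun c' => if c' ∈ S' then avgFun ℰ (update U (centralBond c) y) c' else axialAvg (update U (centralBond c) y) c' :
        GaugeField P (j + 1) G) c))
    (fun _ => (HaarData.haar : Measure G)) A hA0 hAtop hfac
  have hprod : ∏ c, A c = K ^ S'.card := by
    rw [← Finset.prod_filter_mul_prod_filter_not Finset.univ (fun c => c ∈ S')]
    have h1 : Finset.univ.filter (fun c => c ∈ S') = S' := by ext c; simp
    have h2 : ∏ c ∈ Finset.univ.filter (fun c => ¬ c ∈ S'), A c = 1 :=
      Finset.prod_eq_one fun c hc => by
        simp only [Finset.mem_filter, Finset.mem_univ, true_and] at hc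
        simp only [hA, if_neg hc]
    rw [h1, h2, mul_one, Finset.prod_congr rfl fun c hc => show A c = K by simp only [hA, if_pos hc], Finset.prod_const]
  rw [hprod] at hpi
  exact hpi

omit [RegularGaugeGroup G] in
/-- **PER NON-ADMITTING BACKGROUND THE PRODUCT OF THE RESTRICTED FIBRE LAWS IS ZERO** (the guard section of a non-admitting bond of `S` is empty). [folklore] -/
theorem pi_fibre_eq_zero_of_not_admitting (S S' : Finset (PBond P (j + 1))) (U : GaugeField P j G) {c₀ : PBond P (j + 1)} (hc₀ : c₀ ∈ S)
    (hna : ∀ g : G, ¬ Small ℰ (update U (centralBond c₀) g) c₀) :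
    Measure.pi (fun c : PBond P (j + 1) =>
        ((HaarData.haar : Measure G).restrict (if c ∈ S then {y : G | Small ℰ (update U (centralBond c) y) c} else Set.univ)).map
          (fun y => (fun c' => if c' ∈ S' then avgFun ℰ (update U (centralBond c) y) c' else axialAvg (update U (centralBond c) y) c' :
            GaugeField P (j + 1) G) c)) = 0 := by
  classical
  haveI := HaarData.isProb (G := G)
  have hsec0 : (if c₀ ∈ S then {y : G | Small ℰ (update U (centralBond c₀) y) c₀} else Set.univ) = (∅ : Set G) := by
    rw [if_pos hc₀]
    exact Set.eq_empty_of_forall_notMem fun y hy => hna y hy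
  have hzero : ((HaarData.haar : Measure G).restrict (if c₀ ∈ S then {y : G | Small ℰ (update U (centralBond c₀) y) c₀} else Set.univ)).map
      (fun y => (fun c' => if c' ∈ S' then avgFun ℰ (update U (centralBond c₀) y) c' else axialAvg (update U (centralBond c₀) y) c' :
        GaugeField P (j + 1) G) c₀) = 0 := by
    rw [hsec0, Measure.restrict_empty, Measure.map_zero]
  refine Measure.measure_univ_eq_zero.mp ?_
  rw [Measure.pi_univ, Finset.prod_eq_zero (Finset.mem_univ c₀)]
  rw [hzero, Measure.coe_zero, Pi.zero_apply]

end Fibre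

/-! ## §3 The restricted one-level density -/
section Restricted

variable {P : Params} {j : ℕ} {G : Type*} [GaugeGroup G] (ℰ : LoopAverage G) [DecidableEq (PBond P (j + 1))]
  [MeasurableSpace G] [RegularGaugeGroup G] [HaarData G]

/-- ★★★ **(A₁) THE RESTRICTED ONE-LEVEL DENSITY OF THE BRANCH EXPANSION.**  For a small-loop average `ℰ` (measurable kernels), finsets `S′ ⊆ S` of coarse bonds, a constant
`K ∈ [1, ∞)` dominating print's fibre laws on the guard-ADMITTING backgrounds of the bonds of `S′` ((H_K), n08-w3's letter):
`((dU_k) ↾ {U | ∀ c ∈ S, Small ℰ U c}).map (Ū^{S′}) ≤ (K^{|S′|} · dU_k {U | ∀ c ∈ S, ∃ g, Small ℰ (U[β(c) ↦ g]) c}) • dU_{k+1}`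
— the transported «all of `S` fires, EML branch on `S′`» part of product Haar has density at most `K^{|S′|}` times the (outer) probability that the background ADMITS every
guard of `S` (standing range); (A₂) = ✓`measure_forall_guardAdmitting_le` bounds the latter. [cite: Balaban1987RG1, (0.4) p.253; Balaban1985Averaging, (10) p.19] -/
theorem map_restrict_guardAll_hybrid_le (hj : j + 1 ≤ P.m + P.K) (hE : ∀ n, Measurable fun W : Fin (n + 1) → G => ℰ.E W)
    (S S' : Finset (PBond P (j + 1))) (hS' : S' ⊆ S) {K : ℝ≥0∞} (hK1 : 1 ≤ K) (hKtop : K ≠ ∞)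
    (hK : ∀ c ∈ S', ∀ U : GaugeField P j G, (∃ g : G, Small ℰ (update U (centralBond c) g) c) →
      (HaarData.haar : Measure G).map (fun g => avgFun ℰ (update U (centralBond c) g) c) ≤ K • (HaarData.haar : Measure G)) :
    ((fieldMeasure P j G).restrict {U : GaugeField P j G | ∀ c ∈ S, Small ℰ U c}).map
        (fun U : GaugeField P j G => (fun c => if c ∈ S' then avgFun ℰ U c else axialAvg U c : GaugeField P (j + 1) G)) ≤
      (K ^ S'.card * fieldMeasure P j G {U : GaugeField P j G | ∀ c ∈ S, ∃ g : G, Small ℰ (update U (centralBond c) g) c}) •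
        fieldMeasure P (j + 1) G := by
  classical
  haveI := HaarData.isProb (G := G)
  -- letters
  set H : GaugeField P j G → PBond P (j + 1) → G := fun U => fun c => if c ∈ S' then avgFun ℰ U c else axialAvg U c with hH
  have hHm : Measurable H := measurable_hybrid ℰ hE S'
  set res : GaugeField P j G × (PBond P (j + 1) → G) → GaugeField P j G := fun p => Function.extend centralBond p.2 p.1 with hres
  have hβ := centralBond_injective (P := P) (j := j) hj
  have hresmp : MeasurePreserving res ((fieldMeasure P j G).prod (Measure.pi fun _ : PBond P (j + 1) => (HaarData.haar : Measure G)))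
      (fieldMeasure P j G) := measurePreserving_resample (ι := PBond P j) (HaarData.haar : Measure G) hβ
  set GS : Set (GaugeField P j G) := {U : GaugeField P j G | ∀ c ∈ S, Small ℰ U c} with hGS
  have hGSm : MeasurableSet GS := measurableSet_guardAll ℰ S
  set ES : Set (GaugeField P j G) := {U : GaugeField P j G | ∀ c ∈ S, ∃ g : G, Small ℰ (update U (centralBond c) g) c} with hES
  -- the fibre maps and guard sections of §2
  set fib : GaugeField P j G → PBond P (j + 1) → G → G := fun U c y => H (update U (centralBond c) y) c with hfib
  set sec : GaugeField P j G → PBond P (j + 1) → Set G := fun U c =>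
    if c ∈ S then {y : G | Small ℰ (update U (centralBond c) y) c} else Set.univ with hsec
  have hsecm : ∀ U c, MeasurableSet (sec U c) := fun U c => by
    by_cases hc : c ∈ S
    · simp only [hsec, if_pos hc]; exact measurableSet_smallSection ℰ U c
    · simp only [hsec, if_neg hc]; exact MeasurableSet.univ
  -- locality: the composite through the resampling is the coordinatewise fibre map, the guard event is the box of sections
  have hHres : ∀ (U : GaugeField P j G) (g : PBond P (j + 1) → G), H (res (U, g)) = fun c => fib U c (g c) :=
    fun U g => funext fun c => apply_resample_eq (isLocal_hybrid ℰ hj S') hβ U g c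
  have hGres : ∀ (U : GaugeField P j G) (g : PBond P (j + 1) → G), res (U, g) ∈ GS ↔ g ∈ Set.univ.pi (sec U) := by
    intro U g
    simp only [hGS, Set.mem_setOf_eq, Set.mem_univ_pi]
    constructor
    · intro h c
      by_cases hc : c ∈ S
      · simp only [hsec, if_pos hc, Set.mem_setOf_eq]
        exact (small_resample_iff ℰ hj U g c).1 (h c hc)
      · simp only [hsec, if_neg hc]; exact Set.mem_univ _
    · intro h c hc
      have := h c
      simp only [hsec, if_pos hc, Set.mem_setOf_eq] at this
      exact (small_resample_iff ℰ hj U g c).2 this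
  refine Measure.le_iff.2 fun B hB => ?_
  simp only [Measure.map_apply hHm hB, Measure.restrict_apply (hHm hB)]
  -- pull back along the resampling
  have hpre : MeasurableSet (H ⁻¹' B ∩ GS) := (hHm hB).inter hGSm
  rw [← hresmp.measure_preimage hpre.nullMeasurableSet, Measure.prod_apply (hresmp.measurable hpre)]
  -- the section over a background `U`
  have hsection : ∀ U : GaugeField P j G,
      Prod.mk U ⁻¹' (res ⁻¹' (H ⁻¹' B ∩ GS)) = (fun g : PBond P (j + 1) → G => fun c => fib U c (g c)) ⁻¹' B ∩ Set.univ.pi (sec U) := by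
    intro U
    ext g
    simp only [Set.mem_preimage, Set.mem_inter_iff, hHres U g, hGres U g]
  have hfibm : ∀ U c, Measurable (fib U c) := fun U c =>
    (measurable_hybrid_fibreMap ℰ hE S' c).comp (measurable_const.prodMk measurable_id)
  have hFm : ∀ U : GaugeField P j G, Measurable fun g : PBond P (j + 1) → G => fun c => fib U c (g c) := fun U =>
    measurable_pi_lambda _ fun c => (hfibm U c).comp (measurable_pi_apply c)
  -- per background: the restricted product law, dominated by §2
  have hbound : ∀ U : GaugeField P j G,
      (Measure.pi fun _ : PBond P (j + 1) => (HaarData.haar : Measure G)) (Prod.mk U ⁻¹' (res ⁻¹' (H ⁻¹' B ∩ GS))) ≤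
        ES.indicator (fun _ => K ^ S'.card * fieldMeasure P (j + 1) G B) U := by
    intro U
    rw [hsection U, ← Measure.restrict_apply ((hFm U) hB), Measure.restrict_pi_pi,
      ← Measure.map_apply (hFm U) hB]
    have hmap : (Measure.pi fun c => (HaarData.haar : Measure G).restrict (sec U c)).map (fun g : PBond P (j + 1) → G => fun c => fib U c (g c)) =
        Measure.pi fun c => ((HaarData.haar : Measure G).restrict (sec U c)).map (fib U c) :=
      Measure.pi_map_pi fun c => (hfibm U c).aemeasurable
    rw [hmap]
    by_cases hadm : ∀ c ∈ S, ∃ g : G, Small ℰ (update U (centralBond c) g) c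
    · have hUE : U ∈ ES := hadm
      rw [Set.indicator_of_mem hUE]
      exact pi_fibre_le_of_admitting ℰ hj hE S S' hS' hK1 hKtop hK U hadm B
    · have hadm' : ∃ c₀, c₀ ∈ S ∧ ∀ g : G, ¬ Small ℰ (update U (centralBond c₀) g) c₀ := by
        by_contra hcon
        exact hadm fun c hc => by
          by_contra hex
          exact hcon ⟨c, hc, fun g hg => hex ⟨g, hg⟩⟩
      obtain ⟨c₀, hc₀, hna⟩ := hadm'
      rw [pi_fibre_eq_zero_of_not_admitting ℰ S S' U hc₀ hna, Measure.coe_zero, Pi.zero_apply]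
      exact bot_le
  calc ∫⁻ U, (Measure.pi fun _ : PBond P (j + 1) => (HaarData.haar : Measure G)) (Prod.mk U ⁻¹' (res ⁻¹' (H ⁻¹' B ∩ GS))) ∂(fieldMeasure P j G)
      ≤ ∫⁻ U, ES.indicator (fun _ => K ^ S'.card * fieldMeasure P (j + 1) G B) U ∂(fieldMeasure P j G) := lintegral_mono hbound
    _ ≤ ∫⁻ U in ES, K ^ S'.card * fieldMeasure P (j + 1) G B ∂(fieldMeasure P j G) := lintegral_indicator_le _ _
    _ = K ^ S'.card * fieldMeasure P j G ES * fieldMeasure P (j + 1) G B := by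
        rw [setLIntegral_const, mul_right_comm]

end Restricted

end Summit.QuantumFields.YangMills.Theorems.UV3BranchExpansionRestrictedDensity

end
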